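import Summits.PneNP.PneNP.Theorems.ChebyshevTracialDesignTightLayerBimode
import Literature.Combinatorics.AssociationSchemes.HomogeneousMatchingFamilies
import Literature.Combinatorics.AssociationSchemes.SliceLevelInequality
import HarnessLib

/-!
# Cell pnp-psdrank, route `ChebyshevTracialDesign`: the NORMALISED LAYER BOUNDS of spectral non-tightness (SNT) —
# Parseval form, Keevash–Lifshitz form (F2), the slice level-`k` bridge (F1), and the normalised tightness identity

Harmonic backbone of the crux `TracialDecayExp20` (stmt-PneNP-19878), brick 27 (prover g8; step S4 of the `r = 1` rung, MEMO-9 §6 work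
order). Setting: `n` even, `t = 2c'+1` with `2t ≤ n`, a family `X` of `t`-subsets with harmonic layer decomposition `p` of its indicator
(`1_X = Σ_j (Wᵀ)^{t−j} p_j` on the `t`-sets), a set `Y` of perfect matchings, `μ = |X|/C(n,t)`, `ν = |Y|/|PM_n|`, `κ_1` the Gram class
function of the tight incidence, `N_1 = C(n/2, c'+1)·(c'+1)·2` the number of tight `t`-cuts of a matching, and the layer correlations
`T_j(X,Y) = Σ_{M∈Y} Σ_{|U|=t} ((Wᵀ)^{t−j}p_j)(U)·1[cc(U,M) = 1]` of brick 25 (`…TightFreeLayers`), `L_j = ⟪(Wᵀ)^{t−j}p_j,(Wᵀ)^{t−j}p_j⟫`.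
* §1 normalisations: `C(n,t)·λ₀(κ_1) = |PM_n|·N_1²` (brick 17 at level 1); `Σ_j L_j = |X|` (Parseval), so `L_j/C(n,t) ≤ μ`; and the
  **(F1) bridge** `L_j/C(n,t) ≤ 16 μ² (48e(2 ln(1/μ)/j + 3))^j` on balanced slices (`64 ≤ n ≤ 4t`, `1 ≤ j ≤ n/8`) — lit's PROVED
  `SliceLevelInequality.slice_layer_sq_le_log_balanced` read on the ladder form of the decomposition;
* §2 **Parseval form** of the even layers: `|T_{2κ}| ≤ |PM_n|·N_1·√(ν · A_κ · L_{2κ}/C(n,t))`, `A_κ = Π_{i<κ}(2i+1)/(n−2i)` the tight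
  attenuation (brick 25 `abs_layerCorr_le` + `…TightEvenProduct.kernelEigen_tight_even_le_prod` + §1);
* §3 **Keevash–Lifshitz form** (modulo the named fact `GlobalLevelDInequality` = [cite: KeevashLifshitz2023, Thm. 1.8]): for `Y` whose edge
  sets are `(PM_n, τ)`-homogeneous (Kupavskii–Zakharov) and `1 ≤ 2κ ≤ min(⅛ log(1/ν), 10⁻⁵ n)`,
  `|T_{2κ}| ≤ |PM_n|·N_1·ν·(C τ² log(1/ν)/(2κ))^κ·√(A_κ · L_{2κ}/C(n,t))` — brick 26 (`layerCorr_even_eq`, `closedSum_sq_dictionary`) + lit's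
  `HomogeneousMatchingFamilies.pmatch_closedSum_sq_le`; the gain over §2 is the factor `√ν·(C τ² log(1/ν)/(2κ))^κ`;
* §4 the **normalised tightness identity**: for a tight-free rectangle `μ·ν = −Σ_{κ=1}^{c'} T_{2κ}/(|PM_n|·N_1)` (brick 25's identity with the
  odd layers removed by brick 26 and divided by `|PM_n|·N_1`), hence `μν ≤ Σ_{κ=1}^{c'} |T_{2κ}|/(|PM_n|·N_1)`.
The assembly of SNT from these four pieces (head `κ ≤ dq n + 8` by §3 or §2+F1, tail by §2 + Parseval, against §4) is the next file.
[cite: Rothvoss2017, §2 (PDF p. 6)] [cite: BrouwerHaemers2012, Prop. 4.3.2 (PDF p. 83)] [cite: KeevashLifshitz2023, Thm. 1.8]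
[cite: KupavskiiZakharov2022, §2] [cite: ODonnell2014, §9.5]
Stature: support/instrument (S4 of the r = 1 rung of an OPEN crux). WHAT THIS IS NOT: not SNT itself, not the r = 1 rung, no proof of
Keevash–Lifshitz Thm 1.8, nothing on psd rank, no P-vs-NP content. Supports stmt-PneNP-19878.
-/

set_option linter.dupNamespace false -- `Summit.PneNP.PneNP.…`: summit = sub-problem (D-0017)

noncomputable section

namespace Summit.PneNP.PneNP.Theorems.ChebyshevTracialDesignSpectralNonTightnessLayers

open Finset Literature.Barriers.PneNP Literature.Combinatorics.Optimization
open Literature.Combinatorics.AssociationSchemes Literature.Combinatorics.AssociationSchemes.JohnsonHarmonics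
open Literature.Combinatorics.AssociationSchemes.JohnsonSpectrum
open Literature.Combinatorics.AssociationSchemes.HomogeneousMatchingFamilies
open Literature.Combinatorics.AssociationSchemes.SliceLevelInequality
open Literature.Combinatorics.SetFamily
open Literature.Combinatorics.Additive.KeevashLifshitz
open Summit.PneNP.PneNP.Theorems.ChebyshevTracialDesignTightFreeLayers
open Summit.PneNP.PneNP.Theorems.ChebyshevTracialDesignTightLayerBimode
open Summit.PneNP.PneNP.Theorems.ChebyshevTracialDesignTightEvenProduct
open Summit.PneNP.PneNP.Theorems.ChebyshevTracialDesignTightEigenDecay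
open Summit.PneNP.PneNP.Theorems.ChebyshevTracialDesignLevelNormalisation
open Summit.PneNP.PneNP.Theorems.ChebyshevTracialDesignLevelTail
open Summit.PneNP.PneNP.Theorems.ChebyshevTracialDesignProfileExtrapolation
open Summit.PneNP.PneNP.Theorems.ChebyshevTracialDesignProfilePolynomial

variable {n : ℕ}

/-! ### §1 Normalisations: `C(n,t)·λ₀ = |PM|·N_1²`; `Σ_j L_j = |X|`; the (F1) bridge -/

/-- **`C(n,t)·λ₀(κ_1) = |PM_n|·N_1²`** for the Gram class function `κ_1` of the TIGHT incidence on the `t`-sets, `t = 2c'+1 ≤ n/2`,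
`N_1 = C(n/2, 1+c')·C(1+c', c')·2` (brick 17 `kernelEigen_level_zero_eq` at level `1`). [cite: BrouwerHaemers2012, Thm. 4.9.1 (PDF p. 93)] -/
theorem choose_mul_kernelEigen_zero_tight {c' : ℕ} (ht : 2 * (2 * c' + 1) ≤ n) (κ₁ : ℕ → ℝ)
    (hA1 : ∀ U ∈ univ.powersetCard (2 * c' + 1), ∀ U' ∈ univ.powersetCard (2 * c' + 1),
      ∑ M : PMatch n, (if (U.filter fun x => M.2.partner x ∉ U).card = 1 then (1 : ℝ) else 0) *
        (if (U'.filter fun x => M.2.partner x ∉ U').card = 1 then (1 : ℝ) else 0) = κ₁ (U ∩ U').card) :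
    (n.choose (2 * c' + 1) : ℝ) * kernelEigen n (2 * c' + 1) 0 κ₁ =
      (Fintype.card (PMatch n) : ℝ) * ((((n / 2).choose (1 + c') * (1 + c').choose c' * 2 ^ 1 : ℕ) : ℝ)) ^ 2 := by
  have hAm : ∀ U ∈ univ.powersetCard (2 * c' + 1), ∀ U' ∈ univ.powersetCard (2 * c' + 1),
      ∑ M : PMatch n, (if (U.filter fun x => M.2.partner x ∉ U).card = 2 * 0 + 1 then (1 : ℝ) else 0) *
        (if (U'.filter fun x => M.2.partner x ∉ U').card = 2 * 0 + 1 then (1 : ℝ) else 0) = κ₁ (U ∩ U').card := by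
    simpa using hA1
  have h := kernelEigen_level_zero_eq (m := 0) ht (Nat.zero_le c') κ₁ hAm
  have e1 : 2 * 0 + 1 + (c' - 0) = 1 + c' := by omega
  have e2 : c' - 0 = c' := rfl
  have e3 : 2 * 0 + 1 = 1 := rfl
  rw [e1, e2, e3] at h
  exact h

/-- **Parseval for the layers of a family of `t`-subsets**: with `1_X = Σ_{j ≤ t} (Wᵀ)^{t−j} p_j` on the `t`-sets,
`Σ_{j ≤ t} ⟪(Wᵀ)^{t−j}p_j, (Wᵀ)^{t−j}p_j⟫ = |X|`. [cite: MacWilliamsSloane1977, Ch. 21 §6 Thm. 10 (PDF p. 516)] -/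
theorem sum_ladder_ip_eq_card {t : ℕ} (X : Finset (Finset (Fin n))) (hX : X ⊆ univ.powersetCard t)
    (p : ℕ → Finset (Fin n) → ℝ) (hp : ∀ j, IsHarmonic j (p j))
    (hdec : ∀ U ∈ univ.powersetCard t, (if U ∈ X then (1 : ℝ) else 0) = (∑ j ∈ range (t + 1), up^[t - j] (p j)) U) :
    ∑ j ∈ range (t + 1), ip (up^[t - j] (p j)) (up^[t - j] (p j)) = (X.card : ℝ) := by
  rw [sum_congr rfl fun j _ => ip_iterate_up_of_isHarmonic (hp j) (p j) (t - j), ← sum_sq_ladderSum p hp,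
    ← sum_boole_sq_of_subset hX]
  exact sum_congr rfl fun U hU => by rw [hdec U hU]

/-- Each layer norm is at most the total: `⟪(Wᵀ)^{t−j}p_j, (Wᵀ)^{t−j}p_j⟫ ≤ |X|` (`j ≤ t`), i.e. `L_j/C(n,t) ≤ μ(X)`.
[cite: MacWilliamsSloane1977, Ch. 21 §6 Thm. 10 (PDF p. 516)] -/
theorem ladder_ip_le_card {t j : ℕ} (hjt : j ≤ t) (X : Finset (Finset (Fin n))) (hX : X ⊆ univ.powersetCard t)
    (p : ℕ → Finset (Fin n) → ℝ) (hp : ∀ j, IsHarmonic j (p j))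
    (hdec : ∀ U ∈ univ.powersetCard t, (if U ∈ X then (1 : ℝ) else 0) = (∑ j ∈ range (t + 1), up^[t - j] (p j)) U) :
    ip (up^[t - j] (p j)) (up^[t - j] (p j)) ≤ (X.card : ℝ) := by
  rw [← sum_ladder_ip_eq_card X hX p hp hdec]
  exact single_le_sum (f := fun i => ip (up^[t - i] (p i)) (up^[t - i] (p i))) (fun i _ => ip_self_nonneg _)
    (mem_range.2 (by omega))

/-- The density of a family of `t`-subsets is the slice mean of its indicator: `sliceMean n t 1_X = |X|/C(n,t)`. [cite: ODonnell2014, §9.5] -/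
theorem sliceMean_indicator {t : ℕ} (X : Finset (Finset (Fin n))) (hX : X ⊆ univ.powersetCard t) :
    sliceMean n t (fun U => if U ∈ X then (1 : ℝ) else 0) = (X.card : ℝ) / (n.choose t : ℝ) := by
  rw [sliceMean]
  congr 1
  have h := sum_boole_mul_of_subset hX (fun _ => (1 : ℝ))
  simp only [mul_one, sum_const, nsmul_eq_mul] at h
  exact h

/-- **The (F1) bridge**: on a balanced slice (`64 ≤ n ≤ 4t`, `2t ≤ n`) and for `1 ≤ j ≤ n/8`, the ladder norm of the degree-`j` layer of
`1_X` obeys `⟪(Wᵀ)^{t−j}p_j, (Wᵀ)^{t−j}p_j⟫ ≤ 16·C(n,t)·μ²·(48e(2 ln(1/μ)/j + 3))^j`, `μ = |X|/C(n,t)` — lit's PROVED slice level-`j`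
inequality `slice_layer_sq_le_log_balanced` for the rescaled coefficient vectors `(t−i)!·p_i` (`((Wᵀ)^{t−i}p_i)(U) = (t−i)!·zeta p_i (U)`).
[cite: ODonnell2014, §9.5] -/
theorem ladder_ip_le_level {t j : ℕ} (hn : 64 ≤ n) (hbal : n ≤ 4 * t) (h2t : 2 * t ≤ n) (hj1 : 1 ≤ j) (hj : 8 * j ≤ n)
    (X : Finset (Finset (Fin n))) (hX : X ⊆ univ.powersetCard t)
    (p : ℕ → Finset (Fin n) → ℝ) (hp : ∀ j, IsHarmonic j (p j))
    (hdec : ∀ U ∈ univ.powersetCard t, (if U ∈ X then (1 : ℝ) else 0) = (∑ j ∈ range (t + 1), up^[t - j] (p j)) U) :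
    ip (up^[t - j] (p j)) (up^[t - j] (p j)) ≤
      16 * (n.choose t : ℝ) * ((X.card : ℝ) / (n.choose t : ℝ)) ^ 2 *
        (48 * (Real.exp 1 * (2 * Real.log (1 / ((X.card : ℝ) / (n.choose t : ℝ))) / j + 3))) ^ j := by
  have hjt : j ≤ t := by omega
  set q : ℕ → Finset (Fin n) → ℝ := fun i => ((t - i).factorial : ℝ) • p i with hq
  have hq' : ∀ i, IsHarmonic i (q i) := fun i => (hp i).smul _
  set f : Finset (Fin n) → ℝ := fun U => if U ∈ X then (1 : ℝ) else 0 with hf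
  have hf0 : ∀ U : Finset (Fin n), U.card = t → 0 ≤ f U := fun U _ => by
    simp only [hf]; split_ifs <;> norm_num
  have hf1 : ∀ U : Finset (Fin n), U.card = t → f U ≤ 1 := fun U _ => by
    simp only [hf]; split_ifs <;> norm_num
  have hdec' : ∀ U ∈ powersetCard t (univ : Finset (Fin n)), f U = ∑ i ∈ range (t + 1), zeta (q i) U := by
    intro U hU
    have hUt : U.card = t := (mem_powersetCard.1 hU).2
    have h0 := hdec U hU
    simp only [hf]
    rw [h0, Finset.sum_apply]
    refine sum_congr rfl fun i hi => ?_
    have hit : i ≤ t := by have := mem_range.1 hi; omega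
    rw [ladder_apply_eq_factorial_mul_zeta hit (hp i).1 hUt]
    simp only [hq, map_smul, Pi.smul_apply, smul_eq_mul]
  have hmean : sliceMean n t f = (X.card : ℝ) / (n.choose t : ℝ) := sliceMean_indicator X hX
  have key := slice_layer_sq_le_log_balanced hn hbal h2t hj1 hj q hq' f hf0 hf1 hdec'
  rw [hmean] at key
  have hhom : IsHomog t (up^[t - j] (p j)) := by
    have := isHomog_iterate_up (hp j).1 (t - j); rwa [Nat.add_sub_cancel' hjt] at this
  have hL : ip (up^[t - j] (p j)) (up^[t - j] (p j)) = ∑ U ∈ powersetCard t univ, zeta (q j) U ^ 2 := by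
    rw [← sum_powersetCard_mul_of_isHomog _ hhom]
    refine sum_congr rfl fun U hU => ?_
    have hUt : U.card = t := (mem_powersetCard.1 hU).2
    rw [ladder_apply_eq_factorial_mul_zeta hjt (hp j).1 hUt]
    simp only [hq, map_smul, Pi.smul_apply, smul_eq_mul, sq]
  rw [hL]
  exact key

/-! ### §2 The even layer correlations, Parseval form, normalised by `|PM_n|·N_1` -/

/-- **Parseval form of an even layer correlation.** For `n` even, `t = 2c'+1 ≤ n/2`, `κ ≤ c'`:
`|T_{2κ}(X,Y)| ≤ |PM_n|·N_1·√(ν(Y) · Π_{i<κ}(2i+1)/(n−2i) · L_{2κ}/C(n,t))`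
(Cauchy–Schwarz over `Y`, the ladder eigenvalue `λ_{2κ} ≤ λ₀·Π_{i<κ}(2i+1)/(n−2i)` of the tight kernel, and `C(n,t)λ₀ = |PM_n|N_1²`).
[cite: BrouwerHaemers2012, Prop. 4.3.2 (PDF p. 83)] [cite: GodsilMeagher2015, §15.2] -/
theorem abs_layerCorr_even_le_parseval {c' κ : ℕ} (hn : Even n) (ht : 2 * (2 * c' + 1) ≤ n) (hκ : κ ≤ c')
    (Y : Finset (PMatch n)) (p : ℕ → Finset (Fin n) → ℝ) (hp : ∀ j, IsHarmonic j (p j)) (κ₁ : ℕ → ℝ)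
    (hA1 : ∀ U ∈ univ.powersetCard (2 * c' + 1), ∀ U' ∈ univ.powersetCard (2 * c' + 1),
      ∑ M : PMatch n, (if (U.filter fun x => M.2.partner x ∉ U).card = 1 then (1 : ℝ) else 0) *
        (if (U'.filter fun x => M.2.partner x ∉ U').card = 1 then (1 : ℝ) else 0) = κ₁ (U ∩ U').card) :
    |∑ M ∈ Y, ∑ U ∈ univ.powersetCard (2 * c' + 1),
        (up^[2 * c' + 1 - 2 * κ] (p (2 * κ))) U * (if (U.filter fun x => M.2.partner x ∉ U).card = 1 then (1 : ℝ) else 0)| ≤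
      (Fintype.card (PMatch n) : ℝ) * ((((n / 2).choose (1 + c') * (1 + c').choose c' * 2 ^ 1 : ℕ) : ℝ)) *
        Real.sqrt (((Y.card : ℝ) / (Fintype.card (PMatch n) : ℝ)) *
          ((∏ i ∈ range κ, ((2 * i + 1 : ℝ) / ((n : ℝ) - 2 * i))) *
            (ip (up^[2 * c' + 1 - 2 * κ] (p (2 * κ))) (up^[2 * c' + 1 - 2 * κ] (p (2 * κ))) / (n.choose (2 * c' + 1) : ℝ)))) := by
  have h1 := abs_layerCorr_le (t := 2 * c' + 1) (j := 2 * κ) (by omega) Y p hp κ₁ hA1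
  have hlam := kernelEigen_tight_even_le_prod hn ht hκ κ₁ hA1
  have hl0 := choose_mul_kernelEigen_zero_tight ht κ₁ hA1
  set PM : ℝ := (Fintype.card (PMatch n) : ℝ) with hPM
  set N1 : ℝ := ((((n / 2).choose (1 + c') * (1 + c').choose c' * 2 ^ 1 : ℕ) : ℝ)) with hN1
  set Cn : ℝ := (n.choose (2 * c' + 1) : ℝ) with hCn
  set L : ℝ := ip (up^[2 * c' + 1 - 2 * κ] (p (2 * κ))) (up^[2 * c' + 1 - 2 * κ] (p (2 * κ))) with hL
  set A : ℝ := ∏ i ∈ range κ, ((2 * i + 1 : ℝ) / ((n : ℝ) - 2 * i)) with hA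
  have hPMpos : 0 < PM := by rw [hPM]; exact_mod_cast card_pmatch_pos hn
  have hCnpos : 0 < Cn := by rw [hCn]; exact_mod_cast Nat.choose_pos (by omega)
  have hN1 : 0 ≤ N1 := by rw [hN1]; exact_mod_cast Nat.zero_le _
  have hL0 : 0 ≤ L := ip_self_nonneg _
  have hA0 : 0 ≤ A := prod_nonneg fun i hi => (atten_factor_le_one (by have := mem_range.1 hi; omega)).1
  have hY0 : (0 : ℝ) ≤ Y.card := Nat.cast_nonneg _
  have hl0' : kernelEigen n (2 * c' + 1) 0 κ₁ = PM * N1 ^ 2 / Cn := by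
    rw [eq_div_iff hCnpos.ne', mul_comm, hl0]
  refine h1.trans ?_
  rw [show PM * N1 * Real.sqrt ((Y.card : ℝ) / PM * (A * (L / Cn))) =
      Real.sqrt ((PM * N1) ^ 2 * ((Y.card : ℝ) / PM * (A * (L / Cn)))) by
    rw [Real.sqrt_mul (sq_nonneg _), Real.sqrt_sq (by positivity)]]
  apply Real.sqrt_le_sqrt
  calc (Y.card : ℝ) * (kernelEigen n (2 * c' + 1) (2 * κ) κ₁ * L)
      ≤ (Y.card : ℝ) * (kernelEigen n (2 * c' + 1) 0 κ₁ * A * L) := by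
        have : kernelEigen n (2 * c' + 1) (2 * κ) κ₁ * L ≤ kernelEigen n (2 * c' + 1) 0 κ₁ * A * L :=
          mul_le_mul_of_nonneg_right hlam hL0
        exact mul_le_mul_of_nonneg_left this hY0
    _ = (PM * N1) ^ 2 * ((Y.card : ℝ) / PM * (A * (L / Cn))) := by
        rw [hl0']; field_simp

/-! ### §3 The even layer correlations, Keevash–Lifshitz form (F2), normalised by `|PM_n|·N_1` -/

/-- **Keevash–Lifshitz form of an even layer correlation** (modulo `GlobalLevelDInequality`). With the absolute constant `C` of
(F2) (`HomogeneousMatchingFamilies.pmatch_closedSum_sq_le`): for `n` even, `t = 2c'+1 ≤ n/2`, `1 ≤ κ ≤ c'`, `Y` a set of perfect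
matchings whose edge sets are `(PM_n, τ)`-homogeneous (`τ ≥ 1`), `ν = |Y|/|PM_n|`, and `2κ ≤ min(⅛ log(1/ν), 10⁻⁵ n)`:
`|T_{2κ}(X,Y)| ≤ |PM_n|·N_1·ν·(C τ² log(1/ν)/(2κ))^κ·√(Π_{i<κ}(2i+1)/(n−2i) · L_{2κ}/C(n,t))`.
[cite: KeevashLifshitz2023, Thm. 1.8] [cite: KupavskiiZakharov2022, §2] [cite: GodsilMeagher2015, §15.2] -/
theorem abs_layerCorr_even_le_KL (hKL : GlobalLevelDInequality) :
    ∃ C : ℝ, 0 < C ∧ ∀ (n c' κ : ℕ), Even n → 2 * (2 * c' + 1) ≤ n → 1 ≤ κ → κ ≤ c' →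
      ∀ (Y : Finset (PMatch n)) (τ : ℝ), 1 ≤ τ →
      IsRelHomogeneous τ (perfectMatchings (univ : Finset (Fin n))) (Y.image Subtype.val) →
      ((2 * κ : ℕ) : ℝ) ≤ Real.log (1 / ((Y.card : ℝ) / Fintype.card (PMatch n))) / 8 →
      ((2 * κ : ℕ) : ℝ) ≤ (n : ℝ) / 10 ^ 5 →
      ∀ (p : ℕ → Finset (Fin n) → ℝ), (∀ j, IsHarmonic j (p j)) → ∀ (κ₁ : ℕ → ℝ),
      (∀ U ∈ univ.powersetCard (2 * c' + 1), ∀ U' ∈ univ.powersetCard (2 * c' + 1),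
        ∑ M : PMatch n, (if (U.filter fun x => M.2.partner x ∉ U).card = 1 then (1 : ℝ) else 0) *
          (if (U'.filter fun x => M.2.partner x ∉ U').card = 1 then (1 : ℝ) else 0) = κ₁ (U ∩ U').card) →
      |∑ M ∈ Y, ∑ U ∈ univ.powersetCard (2 * c' + 1),
          (up^[2 * c' + 1 - 2 * κ] (p (2 * κ))) U * (if (U.filter fun x => M.2.partner x ∉ U).card = 1 then (1 : ℝ) else 0)| ≤
        (Fintype.card (PMatch n) : ℝ) * ((((n / 2).choose (1 + c') * (1 + c').choose c' * 2 ^ 1 : ℕ) : ℝ)) *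
          (((Y.card : ℝ) / Fintype.card (PMatch n)) *
            (C * τ ^ 2 * (1 / ((2 * κ : ℕ) : ℝ)) * Real.log (1 / ((Y.card : ℝ) / Fintype.card (PMatch n)))) ^ κ *
            Real.sqrt ((∏ i ∈ range κ, ((2 * i + 1 : ℝ) / ((n : ℝ) - 2 * i))) *
              (ip (up^[2 * c' + 1 - 2 * κ] (p (2 * κ))) (up^[2 * c' + 1 - 2 * κ] (p (2 * κ))) / (n.choose (2 * c' + 1) : ℝ)))) := by
  obtain ⟨C, hC, hF2⟩ := pmatch_closedSum_sq_le hKL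
  refine ⟨C, hC, fun n c' κ hn ht hκ1 hκ Y τ hτ hhom h8 h5 p hp κ₁ hA1 => ?_⟩
  have hκn : 4 * κ ≤ n := by omega
  have heven := layerCorr_even_eq hκn hκ Y (hp (2 * κ))
  have hdict := closedSum_sq_dictionary hκn hκ (hp (2 * κ)) κ₁ hA1
  have hlam := kernelEigen_tight_even_le_prod hn ht hκ κ₁ hA1
  have hl0 := choose_mul_kernelEigen_zero_tight ht κ₁ hA1
  have hS := hF2 n Y τ (2 * κ) (p (2 * κ)) hτ hhom (by omega) (hp (2 * κ)) h8 h5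
  set PM : ℝ := (Fintype.card (PMatch n) : ℝ) with hPM
  set N1 : ℝ := ((((n / 2).choose (1 + c') * (1 + c').choose c' * 2 ^ 1 : ℕ) : ℝ)) with hN1
  set Cn : ℝ := (n.choose (2 * c' + 1) : ℝ) with hCn
  set L : ℝ := ip (up^[2 * c' + 1 - 2 * κ] (p (2 * κ))) (up^[2 * c' + 1 - 2 * κ] (p (2 * κ))) with hL
  set A : ℝ := ∏ i ∈ range κ, ((2 * i + 1 : ℝ) / ((n : ℝ) - 2 * i)) with hA
  set ν : ℝ := (Y.card : ℝ) / PM with hν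
  set G : ℝ := C * τ ^ 2 * (1 / ((2 * κ : ℕ) : ℝ)) * Real.log (1 / ν) with hG
  set cκ : ℝ := ((2 * c' + 1 - 2 * κ).factorial : ℝ) *
    (((n : ℝ) - (2 * c' : ℕ) - (2 * κ : ℕ)) * (((n / 2 - 2 * κ).choose (c' - κ) : ℕ) : ℝ)) with hcκ
  set S : ℝ := ∑ M ∈ Y, ∑ T ∈ univ.filter (fun T : Finset (Fin n) => (T.filter fun x => M.2.partner x ∈ T).card = 2 * κ),
    p (2 * κ) T with hSdef
  set Q : ℝ := ∑ M : PMatch n,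
    (∑ T ∈ univ.filter (fun T : Finset (Fin n) => (T.filter fun x => M.2.partner x ∈ T).card = 2 * κ), p (2 * κ) T) ^ 2 with hQ
  have hPMpos : 0 < PM := by rw [hPM]; exact_mod_cast card_pmatch_pos hn
  have hCnpos : 0 < Cn := by rw [hCn]; exact_mod_cast Nat.choose_pos (by omega)
  have hN10 : 0 ≤ N1 := by rw [hN1]; exact_mod_cast Nat.zero_le _
  have hL0 : 0 ≤ L := ip_self_nonneg _
  have hA0 : 0 ≤ A := prod_nonneg fun i hi => (atten_factor_le_one (by have := mem_range.1 hi; omega)).1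
  have hY0 : (0 : ℝ) ≤ Y.card := Nat.cast_nonneg _
  have hν0 : 0 ≤ ν := div_nonneg hY0 hPMpos.le
  have hν1 : ν ≤ 1 := by
    rw [hν, div_le_one hPMpos, hPM]
    exact_mod_cast (card_le_univ Y).trans_eq Finset.card_univ
  have hlog : 0 ≤ Real.log (1 / ν) := by
    rcases hν0.eq_or_lt with h0 | hpos
    · rw [← h0]; simp
    · exact Real.log_nonneg (by rw [le_div_iff₀ hpos, one_mul]; exact hν1)
  have hG0 : 0 ≤ G := by rw [hG]; positivity
  have hl0' : kernelEigen n (2 * c' + 1) 0 κ₁ = PM * N1 ^ 2 / Cn := by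
    rw [eq_div_iff hCnpos.ne', mul_comm, hl0]
  -- `T = cκ · S`, `cκ² Q = λ_{2κ} L`, `S² ≤ ν² G^{2κ} PM Q`
  rw [heven]
  change |cκ * S| ≤ PM * N1 * (ν * G ^ κ * Real.sqrt (A * (L / Cn)))
  have hS' : S ^ 2 ≤ ν ^ 2 * G ^ (2 * κ) * (PM * Q) := hS
  have hT2 : (cκ * S) ^ 2 ≤ (PM * N1 * (ν * G ^ κ)) ^ 2 * (A * (L / Cn)) := by
    calc (cκ * S) ^ 2 = cκ ^ 2 * S ^ 2 := by ring
      _ ≤ cκ ^ 2 * (ν ^ 2 * G ^ (2 * κ) * (PM * Q)) := mul_le_mul_of_nonneg_left hS' (sq_nonneg _)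
      _ = ν ^ 2 * G ^ (2 * κ) * PM * (cκ ^ 2 * Q) := by ring
      _ = ν ^ 2 * G ^ (2 * κ) * PM * (kernelEigen n (2 * c' + 1) (2 * κ) κ₁ * L) := by rw [hdict]
      _ ≤ ν ^ 2 * G ^ (2 * κ) * PM * (kernelEigen n (2 * c' + 1) 0 κ₁ * A * L) := by
          have : kernelEigen n (2 * c' + 1) (2 * κ) κ₁ * L ≤ kernelEigen n (2 * c' + 1) 0 κ₁ * A * L :=
            mul_le_mul_of_nonneg_right hlam hL0
          exact mul_le_mul_of_nonneg_left this (by positivity)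
      _ = (PM * N1 * (ν * G ^ κ)) ^ 2 * (A * (L / Cn)) := by
          have hG2 : G ^ (2 * κ) = (G ^ κ) ^ 2 := by rw [← pow_mul, mul_comm]
          rw [hl0', hG2]; field_simp
  have hrhs : 0 ≤ PM * N1 * (ν * G ^ κ) := by positivity
  calc |cκ * S| = Real.sqrt ((cκ * S) ^ 2) := (Real.sqrt_sq_eq_abs _).symm
    _ ≤ Real.sqrt ((PM * N1 * (ν * G ^ κ)) ^ 2 * (A * (L / Cn))) := Real.sqrt_le_sqrt hT2
    _ = PM * N1 * (ν * G ^ κ) * Real.sqrt (A * (L / Cn)) := by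
        rw [Real.sqrt_mul (sq_nonneg _), Real.sqrt_sq hrhs]
    _ = PM * N1 * (ν * G ^ κ * Real.sqrt (A * (L / Cn))) := by ring

/-! ### §4 The normalised tightness identity over the even layers -/

/-- The even levels `2κ`, `1 ≤ κ ≤ c'`, are exactly the even members of `[1, 2c'+1]`. [folklore] -/
theorem filter_even_Ico_eq_map (c' : ℕ) :
    (Ico 1 (2 * c' + 1 + 1)).filter (fun j => Even j) = (Icc 1 c').map ⟨fun κ => 2 * κ, fun a b h => by simpa using h⟩ := by
  ext j
  simp only [mem_filter, mem_Ico, mem_map, mem_Icc, Function.Embedding.coeFn_mk]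
  constructor
  · rintro ⟨⟨h1, h2⟩, ⟨κ, hκ⟩⟩
    exact ⟨κ, ⟨by omega, by omega⟩, by omega⟩
  · rintro ⟨κ, ⟨h1, h2⟩, rfl⟩
    exact ⟨⟨by omega, by omega⟩, ⟨κ, by ring⟩⟩

/-- **The normalised tightness identity.** For `n` even, `t = 2c'+1 ≤ n/2`, a family `X` of `t`-subsets with harmonic layer decomposition
`p` of its indicator, and a set `Y` of perfect matchings with NO tight pair on `X × Y`:
`μ(X)·ν(Y) = − Σ_{κ=1}^{c'} T_{2κ}(X,Y) / (|PM_n|·N_1)` (brick 25's layer identity, odd layers removed, divided by `|PM_n|·N_1`).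
[cite: Rothvoss2017, §2 (PDF p. 6)] [cite: BrouwerHaemers2012, Prop. 4.3.2 (PDF p. 83)] -/
theorem density_mul_density_eq_neg_sum {c' : ℕ} (hn : Even n) (ht : 2 * (2 * c' + 1) ≤ n) (X : Finset (Finset (Fin n)))
    (hX : X ⊆ univ.powersetCard (2 * c' + 1)) (Y : Finset (PMatch n)) (p : ℕ → Finset (Fin n) → ℝ)
    (hp : ∀ j, IsHarmonic j (p j))
    (hdec : ∀ U ∈ univ.powersetCard (2 * c' + 1),
      (if U ∈ X then (1 : ℝ) else 0) = (∑ j ∈ range (2 * c' + 1 + 1), up^[2 * c' + 1 - j] (p j)) U)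
    (hXY : ∀ U ∈ X, ∀ M ∈ Y, (U.filter fun x => M.2.partner x ∉ U).card ≠ 1) :
    ((X.card : ℝ) / (n.choose (2 * c' + 1) : ℝ)) * ((Y.card : ℝ) / (Fintype.card (PMatch n) : ℝ)) =
      -∑ κ ∈ Icc 1 c', (∑ M ∈ Y, ∑ U ∈ univ.powersetCard (2 * c' + 1),
          (up^[2 * c' + 1 - 2 * κ] (p (2 * κ))) U * (if (U.filter fun x => M.2.partner x ∉ U).card = 1 then (1 : ℝ) else 0)) /
        ((Fintype.card (PMatch n) : ℝ) * ((((n / 2).choose (1 + c') * (1 + c').choose c' * 2 ^ 1 : ℕ) : ℝ))) := by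
  have hid := tightFree_layer_identity (by omega) X hX Y p hp hdec hXY
  set PM : ℝ := (Fintype.card (PMatch n) : ℝ) with hPM
  set N1 : ℝ := ((((n / 2).choose (1 + c') * (1 + c').choose c' * 2 ^ 1 : ℕ) : ℝ)) with hN1
  have hPMpos : 0 < PM := by rw [hPM]; exact_mod_cast card_pmatch_pos hn
  have hN1pos : 0 < N1 := by
    rw [hN1]
    have h1 : 0 < (n / 2).choose (1 + c') := Nat.choose_pos (by omega)
    have h2 : 0 < (1 + c').choose c' := Nat.choose_pos (by omega)
    positivity
  -- remove the odd layers and reindex the even ones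
  have hsum : ∑ j ∈ Ico 1 (2 * c' + 1 + 1), ∑ M ∈ Y, ∑ U ∈ univ.powersetCard (2 * c' + 1),
        (up^[2 * c' + 1 - j] (p j)) U * (if (U.filter fun x => M.2.partner x ∉ U).card = 1 then (1 : ℝ) else 0) =
      ∑ κ ∈ Icc 1 c', ∑ M ∈ Y, ∑ U ∈ univ.powersetCard (2 * c' + 1),
        (up^[2 * c' + 1 - 2 * κ] (p (2 * κ))) U * (if (U.filter fun x => M.2.partner x ∉ U).card = 1 then (1 : ℝ) else 0) := by
    rw [← sum_filter_add_sum_filter_not (Ico 1 (2 * c' + 1 + 1)) (fun j => Even j), filter_even_Ico_eq_map c', sum_map]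
    have hodd : ∑ j ∈ (Ico 1 (2 * c' + 1 + 1)).filter (fun j => ¬Even j), ∑ M ∈ Y, ∑ U ∈ univ.powersetCard (2 * c' + 1),
        (up^[2 * c' + 1 - j] (p j)) U * (if (U.filter fun x => M.2.partner x ∉ U).card = 1 then (1 : ℝ) else 0) = 0 := by
      refine sum_eq_zero fun j hj => ?_
      obtain ⟨hj1, hj2⟩ := mem_filter.1 hj
      exact layerCorr_eq_zero_of_odd ⟨c', rfl⟩ (Nat.not_even_iff_odd.1 hj2) (by have := (mem_Ico.1 hj1).2; omega) Y (hp j)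
    rw [hodd, add_zero]
    rfl
  rw [hsum] at hid
  -- divide by `PM · N1`
  set S : ℝ := ∑ κ ∈ Icc 1 c', ∑ M ∈ Y, ∑ U ∈ univ.powersetCard (2 * c' + 1),
    (up^[2 * c' + 1 - 2 * κ] (p (2 * κ))) U * (if (U.filter fun x => M.2.partner x ∉ U).card = 1 then (1 : ℝ) else 0)
    with hS
  rw [← sum_div]
  change _ = -(S / (PM * N1))
  have key : S = -((X.card : ℝ) / (n.choose (2 * c' + 1) : ℝ) * (N1 * Y.card)) := by linarith
  rw [key]
  field_simp

/-- **Consequence**: for a tight-free rectangle, `μ(X)·ν(Y) ≤ Σ_{κ=1}^{c'} |T_{2κ}(X,Y)| / (|PM_n|·N_1)`. [cite: Rothvoss2017, §2 (PDF p. 6)] -/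
theorem density_mul_density_le_sum_abs {c' : ℕ} (hn : Even n) (ht : 2 * (2 * c' + 1) ≤ n) (X : Finset (Finset (Fin n)))
    (hX : X ⊆ univ.powersetCard (2 * c' + 1)) (Y : Finset (PMatch n)) (p : ℕ → Finset (Fin n) → ℝ)
    (hp : ∀ j, IsHarmonic j (p j))
    (hdec : ∀ U ∈ univ.powersetCard (2 * c' + 1),
      (if U ∈ X then (1 : ℝ) else 0) = (∑ j ∈ range (2 * c' + 1 + 1), up^[2 * c' + 1 - j] (p j)) U)
    (hXY : ∀ U ∈ X, ∀ M ∈ Y, (U.filter fun x => M.2.partner x ∉ U).card ≠ 1) :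
    ((X.card : ℝ) / (n.choose (2 * c' + 1) : ℝ)) * ((Y.card : ℝ) / (Fintype.card (PMatch n) : ℝ)) ≤
      ∑ κ ∈ Icc 1 c', |∑ M ∈ Y, ∑ U ∈ univ.powersetCard (2 * c' + 1),
          (up^[2 * c' + 1 - 2 * κ] (p (2 * κ))) U * (if (U.filter fun x => M.2.partner x ∉ U).card = 1 then (1 : ℝ) else 0)| /
        ((Fintype.card (PMatch n) : ℝ) * ((((n / 2).choose (1 + c') * (1 + c').choose c' * 2 ^ 1 : ℕ) : ℝ))) := by
  rw [density_mul_density_eq_neg_sum hn ht X hX Y p hp hdec hXY, ← sum_neg_distrib]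
  have hpos : (0 : ℝ) < (Fintype.card (PMatch n) : ℝ) * ((((n / 2).choose (1 + c') * (1 + c').choose c' * 2 ^ 1 : ℕ) : ℝ)) := by
    have h1 : 0 < (n / 2).choose (1 + c') := Nat.choose_pos (by omega)
    have h2 : 0 < (1 + c').choose c' := Nat.choose_pos (by omega)
    have h3 := card_pmatch_pos hn
    positivity
  refine sum_le_sum fun κ _ => ?_
  rw [← neg_div]
  exact div_le_div_of_nonneg_right (neg_le_abs _) hpos.le

end Summit.PneNP.PneNP.Theorems.ChebyshevTracialDesignSpectralNonTightnessLayers
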